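import Literature.InformationTheory.Coding.HammingParityCheckMatrix
import Literature.InformationTheory.QuantumCodes.GottesmanCodes
import Literature.InformationTheory.QuantumCodes.OptimalRadius
import HarnessLib

/-!
# The quantum Hamming codes `[[2^r − 1, 2^r − 1 − 2r, 3]]` (`r ≥ 3`): the CSS code of `ℋ_r ⊇ ℋ_r^⊥`

Topic `InformationTheory/QuantumCodes`; namespace `Literature.InformationTheory.QuantumCodes.QuantumHamming`.
LADDER-QEC (cell `qec`), PARTITION row 08, item 08.QHAM.

Steane 1996 (*Simple quantum error-correcting codes*, §3): «When `n = 2^r − 1` we have a perfect Hamming code, and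
for this case the code contains its dual. Therefore … `K = n − 2 log₂(n+1)`», i.e. the CSS code with BOTH check
matrices equal to the Hamming parity-check matrix `H_r` (`HammingParityCheckMatrix.lean`) is an
`[[2^r − 1, 2^r − 1 − 2r, 3]]` code for every `r ≥ 3` («the Hamming codes are a family of ⟦2^r − 1, 2^r − 1 − 2r, 3⟧
quantum error-correcting codes, for `r = 3, 4, 5, …`. They are self-dual perfect CSS codes», Chao–Reichardt 2018);
`r = 3` is Steane's `[[7, 1, 3]]` code.

* `hamMatrix_mul_transpose` — **`H_r H_rᵀ = 0` for `r ≥ 3`** (`ℋ_r^⊥ = 𝒮_r ⊆ ℋ_r`: two rows of `H_r` overlap in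
  `#{v ∈ 𝔽₂^r ∖ 0 : v_c = v_{c'} = 1}` = `2^{r−2}` or `2^{r−1}` positions, even for `r ≥ 3`; the parity device is
  the tree's `sum_apply_mul_apply_eq_zero`);
* `code r hr : CSSCode (Fin r) (Fin r) (Fin (2^r − 1))`, `code_k : k = 2^r − 1 − 2r`;
* `dZ_of_eq`: any CSS code with `H_X = H_Z = H_r` (`r ≥ 3`) has `d_Z = 3` — lower bound = the Hamming distance,
  upper bound = a weight-`3` Hamming codeword, which is not in the row space because row-space words (simplex
  codewords) weigh `0` or `2^{r−1} ≥ 4`; hence `code_dZ`, `code_dX` (`X ↔ Z` symmetric), ★ `code_isCode :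
  (code r hr).IsCode (2^r − 1) (2^r − 1 − 2·r) 3`; instances `steane_isCode : (code 3 _).IsCode 7 1 3`,
  `code15_isCode : [[15, 7, 3]]`, `code31_isCode : [[31, 21, 3]]`;
* Q4 radius: `code_hasOptimalRadius : HasOptimalRadius 1` (Pauli level), `code_minWeight_correctsUpTo`,
  `code_radius_optimal` (sector level) — single-error correction attained by minimum-weight decoding and optimal.

0 named facts, no instances, no notation; axioms standard.

## References
* [Steane1996Simple] A. M. Steane, *Simple quantum error-correcting codes*, PRA 54 (1996) 4741 = quant-ph/9605021,
  §3 (held chunk p0006 L46-58: `K ≤ n − 2⌈log₂(n+1)⌉`, equality for `n = 2^r − 1`, «the code contains its dual»).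
* [ChaoReichardt2018] R. Chao, B. W. Reichardt, PRL 121 (2018) 050502 = arXiv:1705.02329, §II (held chunk p0005
  L3: «a family of ⟦2^r − 1, 2^r − 1 − 2r, 3⟧ quantum error-correcting codes, for r = 3, 4, 5, …»).
* [MacWilliamsSloane1977] Ch. 1 §7, §9 (classical input, via `HammingParityCheckMatrix.lean`).
-/

namespace Literature.InformationTheory.QuantumCodes

open Matrix Finset
open Literature.InformationTheory.Coding Literature.InformationTheory.Coding.HammingMatrix

namespace QuantumHamming

variable {r : ℕ}

/-! ## `ℋ_r` contains its dual (`r ≥ 3`) -/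

/-- **`H_r H_rᵀ = 0` for `r ≥ 3`** («for this case the code contains its dual»).
[cite: Steane1996Simple, §3 (p0006 L55-57: «When n = 2^r − 1 we have a perfect Hamming code, and for this case the code contains its dual»)] -/
theorem hamMatrix_mul_transpose (hr : 3 ≤ r) : hamMatrix r * (hamMatrix r)ᵀ = 0 := by
  ext c c'
  simp only [Matrix.mul_apply, Matrix.transpose_apply, hamMatrix_apply, Matrix.zero_apply]
  rw [sum_col r (fun v => v c * v c') (by simp)]
  exact sum_apply_mul_apply_eq_zero hr c c'

/-! ## The code and its dimension -/

/-- **The quantum Hamming code `QH_r`** (`r ≥ 3`): the CSS code with `H_X = H_Z = H_r` on `2^r − 1` qubits. (definition)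
[cite: Steane1996Simple, §3 (p0006 L55-58)] [cite: ChaoReichardt2018, §II (p0005 L3: «self-dual perfect CSS codes»)] -/
def code (r : ℕ) (hr : 3 ≤ r) : CSSCode (Fin r) (Fin r) (Fin (2 ^ r - 1)) :=
  CSSCode.ofMatrices (hamMatrix r) (hamMatrix r) (hamMatrix_mul_transpose hr)

/-- `H_X = H_r`. [cite: Steane1996Simple, §3 (p0006 L55-58)] -/
@[simp] theorem code_HX (hr : 3 ≤ r) : (code r hr).HX = hamMatrix r := rfl

/-- `H_Z = H_r`. [cite: Steane1996Simple, §3 (p0006 L55-58)] -/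
@[simp] theorem code_HZ (hr : 3 ≤ r) : (code r hr).HZ = hamMatrix r := rfl

/-- `2r + 2 ≤ 2^r` for `r ≥ 3` (so that `k = 2^r − 1 − 2r ≥ 1`). [cite: Steane1996Simple, §3 (p0006 L55-58)] -/
theorem two_mul_add_two_le_two_pow (hr : 3 ≤ r) : 2 * r + 2 ≤ 2 ^ r := by
  induction r, hr using Nat.le_induction with
  | base => norm_num
  | succ n hn ih => rw [pow_succ]; omega

/-- **`k = 2^r − 1 − 2r`** («`K = n − 2 log₂(n+1)`»). [cite: Steane1996Simple, §3 (p0006 L55-58)] -/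
theorem code_k (hr : 3 ≤ r) : (code r hr).k = 2 ^ r - 1 - 2 * r := by
  rw [CSSCode.k_eq, code_HX, code_HZ, rank_hamMatrix, Fintype.card_fin]
  omega

/-! ## Distance `3` -/

/-- **`d_Z = 3` for any CSS code with `H_X = H_Z = H_r`, `r ≥ 3`**: every `Z`-logical is a nonzero Hamming codeword
(weight `≥ 3`), and a weight-`3` Hamming codeword is a `Z`-logical since the `Z`-stabilizers (simplex codewords)
weigh `0` or `2^{r−1} ≥ 4`. [cite: Steane1996Simple, §3 (p0006 L46-58: d = 3 single-error correction with the Hamming check matrix in both bases)] [cite: MacWilliamsSloane1977, Ch. 1 §7, §9 (p0031, p0035)] -/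
theorem dZ_of_eq (hr : 3 ≤ r) (C : CSSCode (Fin r) (Fin r) (Fin (2 ^ r - 1))) (hX : C.HX = hamMatrix r)
    (hZ : C.HZ = hamMatrix r) : C.dZ = 3 := by
  obtain ⟨y, hy, hw⟩ := exists_mulVec_eq_zero_hammingNorm_eq_three r (by omega)
  have h4 : 4 ≤ 2 ^ (r - 1) := by
    have : 2 ^ 2 ≤ 2 ^ (r - 1) := Nat.pow_le_pow_right (by norm_num) (by omega)
    simpa using this
  have hnot : ∀ w : Fin (2 ^ r - 1) → ZMod 2, hammingNorm w = 3 → w ∉ C.rowSpZ := by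
    intro w hw3 hmem
    have hmem' : w ∈ rowSpace (hamMatrix r) := by rw [← hZ]; exact hmem
    rcases hammingNorm_of_mem_rowSpace r hmem' with h0 | h1 <;> omega
  refine C.dZ_eq_of_witness (by rw [hX]; exact hy) (hnot y hw) hw fun w hw0 hw' => ?_
  have hne : w ≠ 0 := by rintro rfl; exact hw' (Submodule.zero_mem _)
  exact three_le_hammingNorm_of_mulVec_eq_zero r (by rw [← hX]; exact hw0) hne

/-- **`d_Z(QH_r) = 3`.** [cite: Steane1996Simple, §3 (p0006 L46-58)] -/
theorem code_dZ (hr : 3 ≤ r) : (code r hr).dZ = 3 := dZ_of_eq hr _ rfl rfl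

/-- **`d_X(QH_r) = 3`** (the construction is symmetric under `X ↔ Z`). [cite: Steane1996Simple, §3 (p0006 L46-58)] -/
theorem code_dX (hr : 3 ≤ r) : (code r hr).dX = 3 := by
  rw [← CSSCode.dZ_swap]; exact dZ_of_eq hr _ rfl rfl

/-- **The quantum Hamming code `QH_r` is `[[2^r − 1, 2^r − 1 − 2r, 3]]`, for every `r ≥ 3`.**
[cite: Steane1996Simple, §3 (p0006 L55-58: n = 2^r − 1, «K = n − 2 log₂(n+1)», d = 3)] [cite: ChaoReichardt2018, §II (p0005 L3: «⟦2^r − 1, 2^r − 1 − 2r, 3⟧ … for r = 3, 4, 5, …»)] -/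
theorem code_isCode (hr : 3 ≤ r) : (code r hr).IsCode (2 ^ r - 1) (2 ^ r - 1 - 2 * r) 3 := by
  have hk := code_k hr
  have hpos : 0 < (code r hr).k := by rw [hk]; have := two_mul_add_two_le_two_pow hr; omega
  have h := (code r hr).isCode_of_dX_dZ hpos (code_dX hr) (code_dZ hr)
  rwa [Fintype.card_fin, hk, min_self] at h

/-- `r = 3`: **Steane's code is `[[7, 1, 3]]`.** [cite: Steane1996Simple, §3 (p0006 L55-58)] [cite: ChaoReichardt2018, §II (p0005 L3)] -/
theorem steane_isCode : (code 3 le_rfl).IsCode 7 1 3 := code_isCode (r := 3) le_rfl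

/-- `r = 4`: `[[15, 7, 3]]`. [cite: ChaoReichardt2018, §II (p0005 L21: «the r = 4, ⟦15,7,3⟧ code»)] -/
theorem code15_isCode : (code 4 (by norm_num)).IsCode 15 7 3 := code_isCode (r := 4) (by norm_num)

/-- `r = 5`: `[[31, 21, 3]]`. [cite: ChaoReichardt2018, §II (p0005 L3)] -/
theorem code31_isCode : (code 5 (by norm_num)).IsCode 31 21 3 := code_isCode (r := 5) (by norm_num)

/-! ## Correction radius `1`, attained and optimal -/

/-- **Optimal correction radius `1` (Pauli level)**: some Pauli decoder of `QH_r` corrects every error of weight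
`≤ 1` and none corrects all of weight `2`. [cite: Steane1996Simple, §3 (p0006 L46: «single error correction, ie d = 3»)] -/
theorem code_hasOptimalRadius (hr : 3 ≤ r) : (code r hr).HasOptimalRadius 1 :=
  (code_isCode hr).hasOptimalRadius_of_eq rfl

/-- **Radius `1` attained sector-wise** by minimum-weight decoding of bit flips and of phase flips.
[cite: Steane1996Simple, §3 (p0006 L46)] -/
theorem code_minWeight_correctsUpTo (hr : 3 ≤ r) :
    (Decoder.minWeight (code r hr).zSyndrome hammingNorm).CorrectsUpTo (code r hr).zSyndrome
        ((code r hr).rowSpZ : Set (Fin (2 ^ r - 1) → ZMod 2)) hammingNorm 1 ∧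
      (Decoder.minWeight (code r hr).xSyndrome hammingNorm).CorrectsUpTo (code r hr).xSyndrome
        ((code r hr).rowSpX : Set (Fin (2 ^ r - 1) → ZMod 2)) hammingNorm 1 :=
  ⟨(code_isCode hr).minWeight_correctsUpToZ, (code_isCode hr).minWeight_correctsUpToX⟩

/-- **… and optimal sector-wise**: no pair of sector decoders of `QH_r` corrects all weight-`t` patterns in both
sectors unless `t ≤ 1`. [cite: Steane1996Simple, §3 (p0006 L46)] -/
theorem code_radius_optimal (hr : 3 ≤ r) {DX DZ : Decoder (Fin r → ZMod 2) (Fin (2 ^ r - 1) → ZMod 2)} {t : ℕ}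
    (hDX : DX.CorrectsUpTo (code r hr).xSyndrome ((code r hr).rowSpX : Set (Fin (2 ^ r - 1) → ZMod 2)) hammingNorm t)
    (hDZ : DZ.CorrectsUpTo (code r hr).zSyndrome ((code r hr).rowSpZ : Set (Fin (2 ^ r - 1) → ZMod 2)) hammingNorm t) :
    t ≤ 1 :=
  (code_isCode hr).le_half_of_correctsUpTo_sectors hDX hDZ

end QuantumHamming

end Literature.InformationTheory.QuantumCodes
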